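import Summits.AtomisticToContinuum.Crystallization.Theorems.PricedLinkCensusStackingHingeLjRegistryDomination
import Summits.AtomisticToContinuum.Crystallization.Theorems.MinMeanCycleStackingLockLockedBoxMinimiserLayerSums
import Summits.AtomisticToContinuum.Crystallization.Theorems.SquareWellLayerCakeStackingFaultSparsityDefs

/-!
# `StackingFaultSparsity` (stmt-AtomisticToContinuum-14296), line `Sketch`: stub `stub_uniformGainOnBox`

The uniform restacking gain on the box, registered stub of the line skeleton
(`Cruxes/StackingFaultSparsity/Lines/Sketch.lean`): a UNIFORM `κ > 0` with

  `2 J₂(a, h) + 2 ∑_{k=3}^{K} (k - 1) |J_k(a, h)| ≤ -κ`   for every `(a, h)` in the box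
  `B = {47/50 ≤ a ≤ 1, 39/50·a ≤ h ≤ 17/20·a}` and every `K ≥ 2`,

`J_k(a, h) = barlowCoupling lennardJones a h k`.  It is the consumable content of item
stmt-AtomisticToContinuum-3063 `PoissonBesselStacking.LjRegistryDomination`, which LANDED
(`PricedHcpWindowsLjRegistry.stub_ljRegistryDomination`): pointwise on the box `J₂ < 0` and
`∑_{k ≥ 3} (k - 1)|J_k| ≤ |J₂|/2`, so `2J₂ + 2∑_{k=3}^{K}(k-1)|J_k| ≤ 2J₂ + |J₂| = J₂ = -|J₂|`;
and `(a, h) ↦ |J₂(a, h)|` is continuous on the compact box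
(`LockedBoxMinimiser.continuousOn_barlowCoupling`), hence bounded below by its positive minimum
`κ`.  All `[folklore]`.
-/

noncomputable section

open scoped BigOperators
open Literature.MathematicalPhysics.StatisticalMechanics
open Summit.AtomisticToContinuum.Crystallization.Theorems.LockedBoxMinimiser (continuousOn_barlowCoupling)

namespace Summit.AtomisticToContinuum.Crystallization.Theorems.SquareWellLayerCake.StackingFaultSparsity

/-- The box `B = {47/50 ≤ a ≤ 1, 39/50·a ≤ h ≤ 17/20·a} ⊆ ℝ²` is compact (closed and bounded).
[folklore] -/
theorem isCompact_inBox : IsCompact {p : ℝ × ℝ | InBox p.1 p.2} := by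
  apply Metric.isCompact_of_isClosed_isBounded
  · have : {p : ℝ × ℝ | InBox p.1 p.2} = {p : ℝ × ℝ | 47 / 50 ≤ p.1} ∩ {p | p.1 ≤ 1} ∩
        {p | 39 / 50 * p.1 ≤ p.2} ∩ {p | p.2 ≤ 17 / 20 * p.1} := by
      ext p; simp only [InBox, Set.mem_setOf_eq, Set.mem_inter_iff]; tauto
    rw [this]
    refine ((IsClosed.inter (IsClosed.inter ?_ ?_) ?_).inter ?_)
    · exact isClosed_le continuous_const continuous_fst
    · exact isClosed_le continuous_fst continuous_const
    · exact isClosed_le (continuous_const.mul continuous_fst) continuous_snd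
    · exact isClosed_le continuous_snd (continuous_const.mul continuous_fst)
  · rw [Metric.isBounded_iff_subset_closedBall (0 : ℝ × ℝ)]
    refine ⟨2, fun p hp => ?_⟩
    simp only [InBox, Set.mem_setOf_eq] at hp
    obtain ⟨h1, h2, h3, h4⟩ := hp
    rw [Metric.mem_closedBall, Prod.dist_eq, Prod.fst_zero, Prod.snd_zero, Real.dist_eq, Real.dist_eq,
      sub_zero, sub_zero, max_le_iff]
    constructor
    · rw [abs_le]; constructor <;> linarith
    · rw [abs_le]; constructor <;> nlinarith

/-- **The uniform gain from `LjRegistryDomination`** (the skeleton's sorry-free reduction, verbatim):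
pointwise on the box `J₂ < 0` and `∑_{k ≥ 3}(k-1)|J_k| ≤ |J₂|/2`, so
`2J₂ + 2∑_{k=3}^{K}(k-1)|J_k| ≤ J₂ = -|J₂|`; `(a,h) ↦ |J₂(a,h)|` is continuous on the compact box, so
`κ := min_B |J₂| > 0` works. [folklore] -/
theorem uniformGainOnBox_of_ljRegistryDomination'
    (hD : Summit.AtomisticToContinuum.Crystallization.Theses.PoissonBesselStacking.LjRegistryDomination) :
    (∃ κ : ℝ, 0 < κ ∧ ∀ a h : ℝ, InBox a h → ∀ K : ℕ, 2 ≤ K →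
      2 * barlowCoupling lennardJones a h 2 +
          2 * ∑ k ∈ Finset.Icc 3 K, ((k : ℝ) - 1) * |barlowCoupling lennardJones a h k| ≤ -κ) := by
  -- continuity of `J₂` on the box
  set f : ℝ × ℝ → ℝ := fun p => |barlowCoupling lennardJones p.1 p.2 2| with hf
  have hcont : ContinuousOn f {p : ℝ × ℝ | InBox p.1 p.2} := by
    have h0 : ContinuousOn (fun p : ℝ × ℝ => barlowCoupling lennardJones p.1 p.2 2)
        (Set.Ici (47 / 50 : ℝ) ×ˢ Set.Ici (1 / 2 : ℝ)) :=
      continuousOn_barlowCoupling (by norm_num) (by norm_num) (by norm_num)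
    refine (h0.mono ?_).norm
    intro p hp
    simp only [InBox, Set.mem_setOf_eq] at hp
    exact ⟨hp.1, by simp only [Set.mem_Ici]; nlinarith [hp.1, hp.2.2.1]⟩
  have hne : ({p : ℝ × ℝ | InBox p.1 p.2} : Set (ℝ × ℝ)).Nonempty :=
    ⟨(1, 4 / 5), by norm_num [InBox]⟩
  obtain ⟨p₀, hp₀, hmin⟩ := isCompact_inBox.exists_isMinOn hne hcont
  refine ⟨f p₀, ?_, ?_⟩
  · -- `J₂(p₀) < 0` by domination at `p₀`
    have hb := hp₀
    simp only [InBox, Set.mem_setOf_eq] at hb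
    obtain ⟨-, hneg, -⟩ := hD p₀.1 p₀.2 hb.1 hb.2.1 hb.2.2.1 hb.2.2.2
    simp only [hf]
    exact abs_pos.2 hneg.ne
  · intro a h hbox K hK
    obtain ⟨hsum, hneg, hdom⟩ := hD a h hbox.1 hbox.2.1 hbox.2.2.1 hbox.2.2.2
    -- finite partial sum ≤ the dominated tsum
    have hfin : ∑ k ∈ Finset.Icc 3 K, ((k : ℝ) - 1) * |barlowCoupling lennardJones a h k| ≤
        ∑' k : ℕ, (if 3 ≤ k then ((k : ℝ) - 1) * |barlowCoupling lennardJones a h k| else 0) := by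
      have hsum' : Summable fun k : ℕ =>
          (if 3 ≤ k then ((k : ℝ) - 1) * |barlowCoupling lennardJones a h k| else 0) := by
        refine Summable.of_nonneg_of_le (fun k => ?_) (fun k => ?_) hsum
        · split_ifs <;> [exact mul_nonneg (by linarith [show (3 : ℝ) ≤ k by exact_mod_cast ‹3 ≤ k›]) (abs_nonneg _); exact le_rfl]
        · split_ifs with h3
          · exact mul_le_mul_of_nonneg_right (by linarith) (abs_nonneg _)
          · positivity
      calc ∑ k ∈ Finset.Icc 3 K, ((k : ℝ) - 1) * |barlowCoupling lennardJones a h k|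
          = ∑ k ∈ Finset.Icc 3 K,
              (if 3 ≤ k then ((k : ℝ) - 1) * |barlowCoupling lennardJones a h k| else 0) := by
            refine Finset.sum_congr rfl fun k hk => ?_
            rw [Finset.mem_Icc] at hk
            rw [if_pos hk.1]
        _ ≤ _ := by
            refine hsum'.sum_le_tsum _ fun k _ => ?_
            split_ifs with h3
            · exact mul_nonneg (by linarith [show (3 : ℝ) ≤ k by exact_mod_cast h3]) (abs_nonneg _)
            · exact le_rfl
    have hmem : (a, h) ∈ {p : ℝ × ℝ | InBox p.1 p.2} := hbox
    have hκ : f p₀ ≤ f (a, h) := (isMinOn_iff.1 hmin) (a, h) hmem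
    have habs : |barlowCoupling lennardJones a h 2| = -barlowCoupling lennardJones a h 2 :=
      abs_of_neg hneg
    linarith

/-- **Stub `stub_uniformGainOnBox` of line `Sketch`** (registered signature, verbatim): a uniform
`κ > 0` with `2 J₂(a,h) + 2 ∑_{k=3}^{K} (k-1)|J_k(a,h)| ≤ -κ` on the box, for every `K ≥ 2` — from the
LANDED item stmt-AtomisticToContinuum-3063 (`PricedHcpWindowsLjRegistry.stub_ljRegistryDomination`)
through `uniformGainOnBox_of_ljRegistryDomination'`. [folklore] -/
theorem stub_uniformGainOnBox :
    (∃ κ : ℝ, 0 < κ ∧ ∀ a h : ℝ, InBox a h → ∀ K : ℕ, 2 ≤ K →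
      2 * barlowCoupling lennardJones a h 2 +
          2 * ∑ k ∈ Finset.Icc 3 K, ((k : ℝ) - 1) * |barlowCoupling lennardJones a h k| ≤ -κ) :=
  uniformGainOnBox_of_ljRegistryDomination' PricedHcpWindowsLjRegistry.stub_ljRegistryDomination

end Summit.AtomisticToContinuum.Crystallization.Theorems.SquareWellLayerCake.StackingFaultSparsity

end
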